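import Mathlib
import HarnessLib

/-!
# Crux `Steer` (stmt-ResolutionOfSingularities-16345), chain W4.1 — §11 INTEGRAL-VERTEX DESCENT WORDS (FILE 0 of the trio):
# `vertexShift` · `IsRemovable` · `Dissolves` · `IsAnisotropicCone` · `NotAlmostPower` and the three Prop words
# `VertexShiftRigidity` · `AnisotropicNoAlmostPower` · `IntegralVertexDescent`, VERBATIM

OURS (campaign `res-hironaka`, rung L ★L-G4, slot W4.1; statements about the route's own objects — the residue-currency words behind
the `XLetterLawIrrEscHat` residual of the β-leaf; they replace the role of no printed item and are NOT statements of the manuscript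
under review [claim: Hironaka2017, status: under-review]; candidates, not facts; AI review is weaker than expert review).
AUTHOR of the mathematics and of the typed words: res-L0-w41-idea-1 g10, `L/res-L0-w41-idea-1/VertexDescent-idea-1-g10.lean`
5662ba702317d2c3 (95 l., Mathlib-only, farm rc 0 · 0 sorries) with memo `CANONICAL-CLEANING-g10.md` 2ea9717796005c14 §11; AUDITS:
res-L0-w41-tri-2 g8 TRIAGE v25-lite (decl-compare PASS) and res-L0-w41-tri-1 v6.22 R-VD (independent PASS; `Odd d` / `NotAlmostPower` /
`3 ≤ d` / `PerfectField κ` load-bearing, mutation witnesses on record). FILED by res-D-repro-2 g9 on res-L0-w41-plan-1 RULING 189c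
(tree layout of record) and custody res-plan-2 IDLE POOL DEAL #30 (4): contents IDENTICAL to the source modulo the namespace
(`…Theorems.SwitchingDichotomy.VertexDescent` instead of `…Cruxes.Steer.Ideas1.VertexDescent`), this header and docstring provenance
prose. FILE 1 `…SteerVertexShiftRigidity` (`vertexShiftRigidity_holds`), FILE 2 `…SteerAnisotropicNoAlmostPower`, FILE 3
`…SteerIntegralVertexDescent` import this file. Mathlib-only (+ HarnessLib); no Theses import; nothing here is a route item or a
registration.

Setting: `κ[Z, W, M] = MvPolynomial (Fin 3) κ` with indices `0 = Z`, `1 = W`, `2 = M`; a `v`-INITIAL FORM at an integral vertex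
`v = (a, b)` of the cleaned polygon is a form `F` of odd degree `d ≥ 3` with `F(Z, W, 0) = Ψ(Z, W)` the (binary, rootless) residue
form of the stage; the vertex move `(z, w) ↦ (z + c₁ x^a y^b, w + c₂ x^a y^b)` acts on `F` by the VERTEX SHIFT
`Z ↦ Z + c₁ M, W ↦ W + c₂ M`; `u`-cleaning deletes the REMOVABLE monomials: class I (the twist `u = x^{e₁} y^{e₂}` and `M`
have matching parities `a ≡ e₁, b ≡ e₂ (mod 2)`) = the monomials `Z^i W^j M^k` with `i, j` even; class II (otherwise) = none
(for odd `d` a monomial `Z^i W^j M^k`, `i + j + k = d`, `i, j` even has `k` odd, so `M^k u` is a square iff the parities match).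
`c` DISSOLVES `F` iff after the shift every surviving monomial with `k ≥ 1` is removable (the vertex disappears after cleaning).

* `VertexShiftRigidity`   — over ANY field of characteristic 2: if `Ψ` has no linear factor of multiplicity `≥ d − 1`, a dissolving
                             vector is UNIQUE (two of them differ by `t ≠ 0` with `Ψ(· + λt) − Ψ` removable for all `λ`, which forces
                             `Ψ = ℓ_t^{d−1}·m`, `ℓ_t = t₂ Z + t₁ W`).
* `AnisotropicNoAlmostPower` — `κ` perfect, `Ψ` anisotropic over `κ`, `L/κ` algebraic ⇒ `Ψ ⊗ L` has no linear factor of multiplicity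
                             `≥ d − 1` (a unique multiple root is Galois-fixed, hence `κ`-rational).
* `IntegralVertexDescent`  — `κ` perfect of characteristic 2, `Ψ` anisotropic over `κ`, `κ'/κ` algebraic: a vector `c ∈ κ'²` dissolving
                             `F ⊗ κ'` lies in `κ²` (so "dissolvable over `κ'` ⇒ dissolvable over `κ`": undissolvability / preparedness of an
                             integral vertex is insensitive to algebraic residue-field extension). Paper proof: the two words above + Galois.
Numerics (exact, OURS; idea-1's script `descent_check.py`): `d = 3`, all `2048` cases (16 twist/parity classes), and `d = 5`, `u = 1`, all
`524 288` cases (kit j283342; plus a 2 500-case sample over all 16 classes) over `𝔽₂ ⊂ 𝔽₄`: `0` forms undissolvable over `𝔽₂` but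
dissolvable over `𝔽₄`; the number of dissolving vectors in `𝔽₄²` is `≤ 1` in every `d = 3` case and in a 1 500-case `d = 5` sample.
The three Prop words are parameterless: provenance in prose only (OURS, invented here; no bracket citation tag — p493706 `relocate`
precedent), as res-L0-w41-plan-1 RULING 189c prescribes. [folklore]
-/

-- `Summit.<S>.<S>.…` duplicates the summit name by design (single-problem summit).
set_option linter.dupNamespace false
set_option autoImplicit false

namespace Summit.ResolutionOfSingularities.ResolutionOfSingularities.Theorems.SwitchingDichotomy.VertexDescent

open MvPolynomial

/-- The VERTEX SHIFT `Z ↦ Z + c₁·M`, `W ↦ W + c₂·M`, `M ↦ M` on `κ[Z, W, M]` (indices `0 = Z, 1 = W, 2 = M`). OURS (res-L0-w41-idea-1 g10). [folklore] -/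
noncomputable def vertexShift {κ : Type} [CommRing κ] (c₁ c₂ : κ) :
    MvPolynomial (Fin 3) κ →ₐ[κ] MvPolynomial (Fin 3) κ :=
  aeval ![X 0 + C c₁ * X 2, X 1 + C c₂ * X 2, X 2]

/-- REMOVABLE monomials at an integral vertex: class I (`evenClass = true`) = even-even in `(Z, W)`; class II = none. OURS (res-L0-w41-idea-1 g10). [folklore] -/
def IsRemovable (evenClass : Bool) (m : Fin 3 →₀ ℕ) : Prop :=
  evenClass = true ∧ Even (m 0) ∧ Even (m 1)

/-- `(c₁, c₂)` DISSOLVES the `v`-initial form `F`: after the vertex shift, every surviving monomial involving `M` is removable. OURS (res-L0-w41-idea-1 g10). [folklore] -/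
def Dissolves {κ : Type} [CommRing κ] (evenClass : Bool) (F : MvPolynomial (Fin 3) κ) (c₁ c₂ : κ) : Prop :=
  ∀ m ∈ (vertexShift c₁ c₂ F).support, 1 ≤ m 2 → IsRemovable evenClass m

/-- The residue cone `Ψ = F(Z, W, 0)` is ANISOTROPIC over `κ`: no non-trivial zero in `κ²`. OURS (res-L0-w41-idea-1 g10). [folklore] -/
def IsAnisotropicCone {κ : Type} [CommRing κ] (F : MvPolynomial (Fin 3) κ) : Prop :=
  ∀ a b : κ, (a ≠ 0 ∨ b ≠ 0) → eval ![a, b, 0] F ≠ 0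

/-- `Ψ = F(Z, W, 0)` is NOT AN ALMOST-POWER over `κ`: no linear factor `ℓ_t = t₂ Z + t₁ W` (`t ≠ 0`) of multiplicity `≥ d − 1`,
read on the binary form `F(Z, W, 0) ∈ κ[Z, W, M]` (substitute `M ↦ 0`). OURS (res-L0-w41-idea-1 g10). [folklore] -/
def NotAlmostPower {κ : Type} [CommRing κ] (F : MvPolynomial (Fin 3) κ) (d : ℕ) : Prop :=
  ¬ ∃ (t₁ t₂ : κ) (m : MvPolynomial (Fin 3) κ), (t₁ ≠ 0 ∨ t₂ ≠ 0) ∧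
      aeval ![X 0, X 1, (0 : MvPolynomial (Fin 3) κ)] F = (C t₂ * X 0 + C t₁ * X 1) ^ (d - 1) * m

/-- VERTEX-SHIFT RIGIDITY (uniqueness of the dissolving vector). Over any field of characteristic `2`, for a form `F` of odd degree
`d ≥ 3` whose cone `F(Z, W, 0)` is not an almost-power, two dissolving vectors coincide. Paper proof (memo §11): with `t = c − c'`,
translation-stability of the removable span gives `Ψ(· + t) − Ψ ∈` removable span; class II: `Ψ(· + t) = Ψ`; class I: the partial
derivatives of `Ψ(· + t) − Ψ` vanish; a homogeneous `g` with `g(· + t) = g` is `α ℓ_t^{deg g}` (compare `W`-degrees after moving `t`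
to `(τ, 0)`); Euler (`d` odd) then gives `Ψ = ℓ_t^{d−1} (α Z + β W)`. Size M. OURS — candidate word invented by res-L0-w41-idea-1 g10 (memo §11), not a
statement of the manuscript under review; provenance in prose only (parameterless Prop). Kernel proof: FILE 1 `vertexShiftRigidity_holds`. -/
def VertexShiftRigidity : Prop :=
  ∀ (κ : Type) [Field κ] [CharP κ 2] (d : ℕ) (evenClass : Bool) (F : MvPolynomial (Fin 3) κ) (c₁ c₂ c₁' c₂' : κ),
    Odd d → 3 ≤ d → F.IsHomogeneous d → NotAlmostPower F d →
    Dissolves evenClass F c₁ c₂ → Dissolves evenClass F c₁' c₂' → c₁ = c₁' ∧ c₂ = c₂'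

/-- ANISOTROPIC ⇒ NOT AN ALMOST-POWER AFTER ALGEBRAIC EXTENSION. `κ` perfect, `F(Z, W, 0)` anisotropic over `κ` of degree `d ≥ 3`,
`L/κ` algebraic: `F(Z, W, 0) ⊗ L` has no linear factor of multiplicity `≥ d − 1` (such a factor is the UNIQUE multiple factor since
`2(d − 1) > d`, hence fixed by `Aut(L̄/κ)`, hence — `κ` perfect — defined over `κ`, giving a `κ`-rational zero). Size S/M. OURS — candidate word
invented by res-L0-w41-idea-1 g10 (memo §11), not a statement of the manuscript under review; provenance in prose only (parameterless Prop).
Kernel proof: FILE 2 `anisotropicNoAlmostPower_holds`. -/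
def AnisotropicNoAlmostPower : Prop :=
  ∀ (κ L : Type) [Field κ] [Field L] [PerfectField κ] [Algebra κ L] [Algebra.IsAlgebraic κ L]
    (d : ℕ) (F : MvPolynomial (Fin 3) κ),
    3 ≤ d → F.IsHomogeneous d → IsAnisotropicCone F → NotAlmostPower (map (algebraMap κ L) F) d

/-- INTEGRAL-VERTEX DESCENT. `κ` perfect of characteristic `2`, `κ'/κ` algebraic, `F` a form of odd degree `d ≥ 3` over `κ` with
anisotropic cone: every vector `c ∈ κ'²` dissolving `F ⊗ κ'` is `κ`-rational. Consequently an integral vertex that is undissolvable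
(prepared) over `κ` stays undissolvable over every algebraic residue-field extension — the descent step of the `XLetterLawIrrEscHat`
route (memo §10/§11). Paper proof: `VertexShiftRigidity` over the Galois closure (`AnisotropicNoAlmostPower` supplies its hypothesis)
makes `c` Galois-fixed; `κ` perfect ⇒ `c ∈ κ²`. Size M. OURS — candidate word invented by res-L0-w41-idea-1 g10 (memo §10/§11),
not a statement of the manuscript under review; provenance in prose only (parameterless Prop). Kernel proof: FILE 3
`integralVertexDescent_holds`. -/
def IntegralVertexDescent : Prop :=
  ∀ (κ κ' : Type) [Field κ] [Field κ'] [CharP κ 2] [PerfectField κ] [Algebra κ κ'] [Algebra.IsAlgebraic κ κ']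
    (d : ℕ) (evenClass : Bool) (F : MvPolynomial (Fin 3) κ) (c₁ c₂ : κ'),
    Odd d → 3 ≤ d → F.IsHomogeneous d → IsAnisotropicCone F →
    Dissolves evenClass (map (algebraMap κ κ') F) c₁ c₂ →
    ∃ c₁' c₂' : κ, c₁ = algebraMap κ κ' c₁' ∧ c₂ = algebraMap κ κ' c₂'

/-- Sanity (definitional): the zero vector dissolves `F` iff `F` has no non-removable monomial involving `M`, i.e. `v` was not a
genuine vertex of the CLEANED polygon. OURS (res-L0-w41-idea-1 g10). [folklore] -/
theorem dissolves_zero_iff {κ : Type} [CommRing κ] (evenClass : Bool) (F : MvPolynomial (Fin 3) κ) :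
    Dissolves evenClass F 0 0 ↔ ∀ m ∈ F.support, 1 ≤ m 2 → IsRemovable evenClass m := by
  have h : vertexShift (0 : κ) 0 F = F := by
    have hfun : (![X 0 + C (0 : κ) * X 2, X 1 + C (0 : κ) * X 2, X 2] : Fin 3 → MvPolynomial (Fin 3) κ) = X := by
      funext i; fin_cases i <;> simp
    simp only [vertexShift, hfun, aeval_X_left, AlgHom.coe_id, id_eq]
  simp only [Dissolves, h]


end Summit.ResolutionOfSingularities.ResolutionOfSingularities.Theorems.SwitchingDichotomy.VertexDescent
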